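/-
Copyright: rh-split cell, seat prover-l1 (L1/L19 «DUST WALL»), 2026-08-27.  ζ-free analysis.
Nothing here bears on the truth of RH.
-/
import Summits.RiemannHypothesis.RiemannHypothesis.Theorems.Splittings.ScrewDustCellFlux
import HarnessLib

/-!
# No small wall-free grid cycles around an inside pole (the Tannery step)

ζ-free kernel piece for the crux `PointComponentInvisible` (route `ScrewDustWall`, X-11 «DUST WALL»,
stmt-RiemannHypothesis-21690): the analogue of `ScrewBorelFlux.false_of_small_circles` (§20) with
circles replaced by boundaries of CELL COMPLEXES.

**Theorem** (`false_of_small_cellComplexes`).  `c` absolutely summable with `Re c_i < 0`, `u_i ≠ 0`,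
`F` holomorphic on the unit disc and equal to the Borel series `B` on a pole-free disc `ball 0 r₀`
(`r₀ ≤ ‖q‖` for every inside pole `q`), `p` an inside pole.  Then it is IMPOSSIBLE that for every
`ε > 0` there is a finite complex `H` of grid cells, all inside `ball p ε`, one of whose OPEN cells
contains `p`, with no pole `u i`, `(u i)⁻¹` on an edge of a cell of `H`, and all of whose exposed edges
lie in the origin's component `Ω₀` of `𝔻 ∖ closure (poleSet u)`.
Proof: by the flux theorem (`cellComplex_charge_eq_zero`, with `V = Ω₀`) the total charge enclosed by
each such complex vanishes; as `ε → 0` the charge of the term `i` is eventually `p · poleCoeff (c i)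
(u i) p` and is bounded by `‖c i‖`, so (Tannery) the total charge tends to `p · C_p` with
`Re C_p < 0` (`ScrewBorelFlux.re_tsum_poleCoeff_neg`), `p ≠ 0`: contradiction.

No `sorry`, no new axioms, no definitions, no instances, no notation.
-/

set_option linter.dupNamespace false

namespace Summit.RiemannHypothesis.RiemannHypothesis.Theorems.Splittings.ScrewDust

open Complex Filter Topology Set Metric
open scoped Real Classical
open Summit.RiemannHypothesis.RiemannHypothesis.Theorems.Splittings.ScrewBorel
open Summit.RiemannHypothesis.RiemannHypothesis.Theorems.Splittings.ScrewBorelFlux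

/-! ## 1. Open cells of a grid are pairwise disjoint -/

/-- Two open cells of a (non-decreasing) grid containing a common point coincide. -/
theorem cell_eq_of_mem {x y : ℤ → ℝ} (hx : Monotone x) (hy : Monotone y) {q : ℂ} {k k' : ℤ × ℤ}
    (hk : q ∈ Ioo (x k.1) (x (k.1 + 1)) ×ℂ Ioo (y k.2) (y (k.2 + 1)))
    (hk' : q ∈ Ioo (x k'.1) (x (k'.1 + 1)) ×ℂ Ioo (y k'.2) (y (k'.2 + 1))) : k = k' := by
  rw [mem_reProdIm, mem_Ioo, mem_Ioo] at hk hk'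
  have h1 : ∀ {f : ℤ → ℝ}, Monotone f → ∀ {m m' : ℤ} {t : ℝ}, f m < t → t < f (m + 1) →
      f m' < t → t < f (m' + 1) → m = m' := by
    intro f hf m m' t h1 h2 h3 h4
    by_contra hne
    rcases lt_or_gt_of_ne hne with h | h
    · have : f (m + 1) ≤ f m' := hf (by omega)
      linarith
    · have : f (m' + 1) ≤ f m := hf (by omega)
      linarith
  exact Prod.ext (h1 hx hk.1.1 hk.1.2 hk'.1.1 hk'.1.2) (h1 hy hk.2.1 hk.2.2 hk'.2.1 hk'.2.2)

/-- The charge summed over the cells of a complex only sees in WHICH open cell (if any) a pole lies. -/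
theorem sum_ite_mem_cell {x y : ℤ → ℝ} (hx : Monotone x) (hy : Monotone y) (H : Finset (ℤ × ℤ))
    (q v : ℂ) :
    ∑ k ∈ H, (if q ∈ Ioo (x k.1) (x (k.1 + 1)) ×ℂ Ioo (y k.2) (y (k.2 + 1)) then v else 0) =
      if ∃ k ∈ H, q ∈ Ioo (x k.1) (x (k.1 + 1)) ×ℂ Ioo (y k.2) (y (k.2 + 1)) then v else 0 := by
  by_cases h : ∃ k ∈ H, q ∈ Ioo (x k.1) (x (k.1 + 1)) ×ℂ Ioo (y k.2) (y (k.2 + 1))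
  · obtain ⟨k₀, hk₀, hq⟩ := h
    rw [if_pos ⟨k₀, hk₀, hq⟩, Finset.sum_eq_single_of_mem k₀ hk₀ fun k _ hne ↦ ?_, if_pos hq]
    exact if_neg fun hq' ↦ hne (cell_eq_of_mem hx hy hq' hq)
  · rw [if_neg h]
    exact Finset.sum_eq_zero fun k hk ↦ if_neg fun hq ↦ h ⟨k, hk, hq⟩

/-- Norm of the charge of one term: `≤ ‖c‖` whenever the poles counted lie in the unit disc
(instance-agnostic form of `norm_setCharge_le`). -/
theorem norm_ite_add_ite_le {c u : ℂ} {P Q : Prop} [Decidable P] [Decidable Q]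
    (hP : P → ‖u⁻¹‖ < 1) (hQ : Q → ‖u‖ < 1) :
    ‖(if P then c / 2 * u⁻¹ else 0) + (if Q then c / 2 * u else 0)‖ ≤ ‖c‖ := by
  have h2 : ‖c / 2‖ = ‖c‖ / 2 := by rw [norm_div]; simp
  have hq : ∀ q : ℂ, ‖q‖ < 1 → ‖c / 2 * q‖ ≤ ‖c‖ / 2 := by
    intro q hq
    rw [norm_mul, h2]
    calc ‖c‖ / 2 * ‖q‖ ≤ ‖c‖ / 2 * 1 := by gcongr
      _ = ‖c‖ / 2 := mul_one _
  have h0 := norm_nonneg c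
  refine (norm_add_le _ _).trans ?_
  split_ifs with ha hb hb
  · linarith [hq _ (hP ha), hq _ (hQ hb)]
  · rw [norm_zero]; linarith [hq _ (hP ha)]
  · rw [norm_zero]; linarith [hq _ (hQ hb)]
  · rw [norm_zero]; linarith

/-! ## 2. The Tannery step -/

/-- **No small wall-free grid cycles around an inside pole (ζ-free).**  See the module docstring.
The exposed-edge conditions are those of `cellComplex_charge_eq_zero` with
`V = connectedComponentIn (𝔻 ∖ closure (poleSet u)) 0`. -/
theorem false_of_small_cellComplexes {ι : Type*} {c u : ι → ℂ} (hc : Summable fun i ↦ ‖c i‖)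
    (hre : ∀ i, (c i).re < 0) (hu : ∀ i, u i ≠ 0) {F : ℂ → ℂ} (hF : DifferentiableOn ℂ F (ball 0 1))
    {r₀ : ℝ} (hr₀ : 0 < r₀) (hS : ∀ q ∈ poleSet u, r₀ ≤ ‖q‖)
    (hFB : EqOn F (fun z ↦ ∑' i, term (c i) (u i) z) (ball 0 r₀)) {p : ℂ} (hp : p ∈ poleSet u)
    (hH : ∀ ε > 0, ∃ (x y : ℤ → ℝ) (H : Finset (ℤ × ℤ)),
      (∀ m, x m ≤ x (m + 1)) ∧ (∀ n, y n ≤ y (n + 1)) ∧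
      (∃ k ∈ H, p ∈ Ioo (x k.1) (x (k.1 + 1)) ×ℂ Ioo (y k.2) (y (k.2 + 1))) ∧
      (∀ k ∈ H, Icc (x k.1) (x (k.1 + 1)) ×ℂ Icc (y k.2) (y (k.2 + 1)) ⊆ ball p ε) ∧
      (∀ i, ∀ k ∈ H, ∀ q : ℂ, q = u i ∨ q = (u i)⁻¹ →
        q ∈ Ioo (x k.1) (x (k.1 + 1)) ×ℂ Ioo (y k.2) (y (k.2 + 1)) ∨
          q ∉ Icc (x k.1) (x (k.1 + 1)) ×ℂ Icc (y k.2) (y (k.2 + 1))) ∧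
      (∀ k ∈ H, (k.1, k.2 - 1) ∉ H → (fun t : ℝ ↦ (t : ℂ) + y k.2 * I) '' Icc (x k.1) (x (k.1 + 1)) ⊆
        connectedComponentIn (ball (0 : ℂ) 1 \ closure (poleSet u)) 0) ∧
      (∀ k ∈ H, (k.1, k.2 + 1) ∉ H →
        (fun t : ℝ ↦ (t : ℂ) + y (k.2 + 1) * I) '' Icc (x k.1) (x (k.1 + 1)) ⊆
          connectedComponentIn (ball (0 : ℂ) 1 \ closure (poleSet u)) 0) ∧
      (∀ k ∈ H, (k.1 - 1, k.2) ∉ H → (fun t : ℝ ↦ (x k.1 : ℂ) + t * I) '' Icc (y k.2) (y (k.2 + 1)) ⊆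
        connectedComponentIn (ball (0 : ℂ) 1 \ closure (poleSet u)) 0) ∧
      (∀ k ∈ H, (k.1 + 1, k.2) ∉ H →
        (fun t : ℝ ↦ (x (k.1 + 1) : ℂ) + t * I) '' Icc (y k.2) (y (k.2 + 1)) ⊆
          connectedComponentIn (ball (0 : ℂ) 1 \ closure (poleSet u)) 0)) : False := by
  haveI : Countable ι := countable_of_summable_of_re_neg hc hre
  have hp1 : ‖p‖ < 1 := hp.1
  have hp0 : p ≠ 0 := by
    obtain ⟨i, hi | hi⟩ := hp.2
    · rw [hi]; exact hu i
    · rw [hi]; exact inv_ne_zero (hu i)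
  set C : ℂ := ∑' i, poleCoeff (c i) (u i) p with hC
  have hCre : C.re < 0 := re_tsum_poleCoeff_neg hc hre hp
  have hpC : p * C ≠ 0 :=
    mul_ne_zero hp0 fun h ↦ by rw [h, Complex.zero_re] at hCre; exact lt_irrefl _ hCre
  -- the origin's component of the regular set
  set W : Set ℂ := closure (poleSet u) with hW
  set V : Set ℂ := connectedComponentIn (ball (0 : ℂ) 1 \ W) 0 with hVdef
  have h0W : (0 : ℂ) ∉ W := fun h ↦ by
    have hsub : W ⊆ {z : ℂ | r₀ ≤ ‖z‖} :=
      closure_minimal (fun q hq ↦ hS q hq) (isClosed_le continuous_const continuous_norm)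
    have := hsub h
    rw [mem_setOf_eq, norm_zero] at this
    linarith
  have hV : IsPreconnected V := isPreconnected_connectedComponentIn
  have hV0 : (0 : ℂ) ∈ V := mem_connectedComponentIn ⟨mem_ball_self one_pos, h0W⟩
  have hVsub : V ⊆ ball 0 1 \ W := connectedComponentIn_subset _ _
  -- a sequence of complexes at scales `ε n → 0`
  set ε : ℕ → ℝ := fun n ↦ (1 - ‖p‖) / (n + 2) with hε
  have hεpos : ∀ n, 0 < ε n := fun n ↦ div_pos (by linarith) (by positivity)
  have hεlt : ∀ n, ε n < 1 - ‖p‖ := fun n ↦ by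
    rw [hε]
    refine div_lt_self (by linarith) ?_
    have : (0 : ℝ) ≤ n := n.cast_nonneg
    linarith
  choose x y H hxm hym hpH hHε hoff hbot htop hlef hrig using fun n ↦ hH (ε n) (hεpos n)
  have hxM : ∀ n, Monotone (x n) := fun n ↦ monotone_int_of_le_succ (hxm n)
  have hyM : ∀ n, Monotone (y n) := fun n ↦ monotone_int_of_le_succ (hym n)
  have hball : ∀ n, ball p (ε n) ⊆ ball (0 : ℂ) 1 := fun n z hz ↦ by
    rw [mem_ball, dist_eq_norm] at hz
    rw [mem_ball_zero_iff]
    calc ‖z‖ = ‖p + (z - p)‖ := by congr 1; ring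
      _ ≤ ‖p‖ + ‖z - p‖ := norm_add_le _ _
      _ < 1 := by linarith [hεlt n]
  -- the charges and the flux theorem
  set f : ℕ → ι → ℂ := fun n i ↦ ∑ k ∈ H n,
    ((if (u i)⁻¹ ∈ Ioo (x n k.1) (x n (k.1 + 1)) ×ℂ Ioo (y n k.2) (y n (k.2 + 1))
        then c i / 2 * (u i)⁻¹ else 0) +
      (if u i ∈ Ioo (x n k.1) (x n (k.1 + 1)) ×ℂ Ioo (y n k.2) (y n (k.2 + 1))
        then c i / 2 * u i else 0)) with hf
  have hf0 : ∀ n, ∑' i, f n i = 0 := fun n ↦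
    cellComplex_charge_eq_zero hc hu hF hr₀ hFB hV hV0 hVsub (hxm n) (hym n) (H n)
      (fun k hk ↦ (hHε n k hk).trans (hball n)) (hoff n) (hbot n) (htop n) (hlef n) (hrig n)
  -- the charge of one term in set form
  have hfU : ∀ n i, f n i =
      (if ∃ k ∈ H n, (u i)⁻¹ ∈ Ioo (x n k.1) (x n (k.1 + 1)) ×ℂ Ioo (y n k.2) (y n (k.2 + 1))
        then c i / 2 * (u i)⁻¹ else 0) +
      (if ∃ k ∈ H n, u i ∈ Ioo (x n k.1) (x n (k.1 + 1)) ×ℂ Ioo (y n k.2) (y n (k.2 + 1))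
        then c i / 2 * u i else 0) := by
    intro n i
    simp only [hf, Finset.sum_add_distrib, sum_ite_mem_cell (hxM n) (hyM n)]
  -- membership in the open cells of `H n`: for a pole `q` of the term, iff `q = p` once `ε n` is small
  have hmem_p : ∀ n, ∃ k ∈ H n, p ∈ Ioo (x n k.1) (x n (k.1 + 1)) ×ℂ Ioo (y n k.2) (y n (k.2 + 1)) :=
    hpH
  have hmem_imp : ∀ n (q : ℂ), (∃ k ∈ H n, q ∈ Ioo (x n k.1) (x n (k.1 + 1)) ×ℂ
      Ioo (y n k.2) (y n (k.2 + 1))) → ‖q - p‖ < ε n := by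
    rintro n q ⟨k, hk, hq⟩
    have hq' : q ∈ Icc (x n k.1) (x n (k.1 + 1)) ×ℂ Icc (y n k.2) (y n (k.2 + 1)) :=
      ⟨Ioo_subset_Icc_self hq.1, Ioo_subset_Icc_self hq.2⟩
    have := hHε n k hk hq'
    rwa [mem_ball, dist_eq_norm] at this
  -- Tannery
  have hlim : Tendsto (fun n ↦ ∑' i, f n i) atTop (𝓝 (∑' i, p * poleCoeff (c i) (u i) p)) := by
    refine tendsto_tsum_of_dominated_convergence (bound := fun i ↦ ‖c i‖) hc (fun i ↦ ?_) ?_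
    · -- eventually constant `= p · poleCoeff`
      set m : ℝ := min (if (u i)⁻¹ = p then 1 else ‖(u i)⁻¹ - p‖) (if u i = p then 1 else ‖u i - p‖)
        with hm
      have hm0 : 0 < m := by
        rw [hm]
        refine lt_min ?_ ?_ <;> split_ifs with h
        · exact one_pos
        · exact norm_pos_iff.2 (sub_ne_zero.2 h)
        · exact one_pos
        · exact norm_pos_iff.2 (sub_ne_zero.2 h)
      obtain ⟨N, hN⟩ := exists_nat_gt ((1 - ‖p‖) / m)
      refine tendsto_const_nhds.congr' (eventually_atTop.2 ⟨N, fun n hn ↦ ?_⟩)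
      have hεm : ε n < m := by
        rw [hε, div_lt_iff₀ (by positivity)]
        rw [div_lt_iff₀ hm0] at hN
        have : (N : ℝ) ≤ n := by exact_mod_cast hn
        nlinarith
      have key : ∀ q : ℂ, (q = p → True) → (q ≠ p → m ≤ ‖q - p‖) →
          ((∃ k ∈ H n, q ∈ Ioo (x n k.1) (x n (k.1 + 1)) ×ℂ Ioo (y n k.2) (y n (k.2 + 1))) ↔ q = p) := by
        intro q _ hq
        constructor
        · intro h
          by_contra hne
          have := hmem_imp n q h
          linarith [hq hne]
        · rintro rfl
          exact hmem_p n
      have k1 := key (u i)⁻¹ (fun _ ↦ trivial) fun h ↦ by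
        have := min_le_left (if (u i)⁻¹ = p then 1 else ‖(u i)⁻¹ - p‖) (if u i = p then 1 else ‖u i - p‖)
        rw [← hm] at this
        rwa [if_neg h] at this
      have k2 := key (u i) (fun _ ↦ trivial) fun h ↦ by
        have := min_le_right (if (u i)⁻¹ = p then 1 else ‖(u i)⁻¹ - p‖) (if u i = p then 1 else ‖u i - p‖)
        rw [← hm] at this
        rwa [if_neg h] at this
      show p * poleCoeff (c i) (u i) p = f n i
      rw [hfU]
      simp only [k1, k2]
      unfold poleCoeff
      by_cases h1 : (u i)⁻¹ = p
      · by_cases h2 : u i = p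
        · rw [if_pos h1, if_pos h2, if_pos h1, if_pos h2, h1, h2]; ring
        · rw [if_pos h1, if_neg h2, if_pos h1, if_neg h2, h1]; ring
      · by_cases h2 : u i = p
        · rw [if_neg h1, if_pos h2, if_neg h1, if_pos h2, h2]; ring
        · rw [if_neg h1, if_neg h2, if_neg h1, if_neg h2]; ring
    · refine Eventually.of_forall fun n i ↦ ?_
      rw [hfU]
      have hU : ∀ q : ℂ, (∃ k ∈ H n, q ∈ Ioo (x n k.1) (x n (k.1 + 1)) ×ℂ
          Ioo (y n k.2) (y n (k.2 + 1))) → ‖q‖ < 1 := fun q hq ↦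
        mem_ball_zero_iff.1 (hball n (by rw [mem_ball, dist_eq_norm]; exact hmem_imp n q hq))
      exact norm_ite_add_ite_le (hU _) (hU _)
  rw [tsum_mul_left] at hlim
  have hzero : (fun n ↦ ∑' i, f n i) = fun _ ↦ (0 : ℂ) := funext hf0
  rw [hzero] at hlim
  exact hpC (by rw [hC]; exact tendsto_nhds_unique hlim tendsto_const_nhds)

end Summit.RiemannHypothesis.RiemannHypothesis.Theorems.Splittings.ScrewDust
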